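/-
Copyright (c) 2026. All rights reserved.
Released under Apache 2.0 license as described in the file LICENSE.
-/
import Literature.NumberTheory.Weil1964.AdelicMetaplecticRationalLift
import HarnessLib

/-!
# The rational symplectic element `δ` carrying the diagonal of `W ⊕ W⁻` onto the Lagrangian `𝕐`

Topic `NumberTheory/Weil1964`; namespace `Literature.NumberTheory.Weil1964`.  KERNEL MATHEMATICS ONLY: no
`def … : Prop` record of a published theorem, no `axiom`, no proof hole.  Origin: `pub-hodgecm` SEAMS sprint, site
S4-10 (change of polarisation in the doubling method, [Li1992, p. 181]: "let `δ ∈ Sp(𝕎)(F)` be an element carrying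
the diagonal `W^Δ` to `𝕐`"), the object-side instantiation of the hypothesis `hW` of the diagonal-kernel identity
`(ω(r_F γ) Ψ)(0) = ∫ Ψ(u,u) du` (kernel item (b)).

SETTING.  For a Gram matrix `T` on `K^ι` the DOUBLED space `𝕎 = W ⊕ W⁻` has Gram matrix
`T₂ = fromBlocks T 0 0 (−T)` on `K^{ι ⊕ ι}`; in the tree's polarisation `𝕎 = 𝕏 ⊕ 𝕐`, `𝕏 = K^{ι⊕ι} × {0}`,
`𝕐 = {0} × K^{ι⊕ι}` (`Heisenberg (polar β_{T₂})`, `adelicSchrodinger F (ι ⊕ ι) T₂` acts on functions on `𝕏`), the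
diagonal is `W^Δ = {((a,a),(b,b))}`.  Mathlib's matrix symplectic group `Sp_{2(ι⊕ι)}(K)` (`A J Aᵀ = J`,
`J = fromBlocks 0 (−1) 1 0`) is transported to `Sp(𝕎)` by the tree's `transportSp T₂` (`A ↦ P⁻¹ A P`,
`P(x, y) = (x, T₂ y)`, `SymplecticMatrixTransport.lean`) and the rational points by `ratSpι F (ι ⊕ ι) T₂`
(`AdelicMetaplecticRationalLift.lean`).

WHAT IS HERE (all proved):
* `deltaDiagMatrix : Matrix ((ι⊕ι)⊕(ι⊕ι)) ((ι⊕ι)⊕(ι⊕ι)) K`, the explicit matrix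
  `(X₁, X₂; Y₁, Y₂) ↦ (X₁ − X₂, Y₁ + Y₂; Y₁, −X₂)` with entries in `{0, ±1}`, and `deltaDiagMatrix_mem`: it lies in
  Mathlib's `Matrix.symplecticGroup (ι ⊕ ι) K` (`deltaDiag : Matrix.symplecticGroup (ι ⊕ ι) K`); it is defined over
  the prime ring, so `mapHom f deltaDiag = deltaDiag` for every ring map `f` (`mapHom_deltaDiag`).
* **`transportSp T₂ deltaDiag` CARRIES `W^Δ` ONTO `𝕐`** with the explicit parametrisation
  `δ ((T y₂, T y₂), (y₁, y₁)) = (0, (y₁, y₂))` (`transportSp_deltaDiag_diag`), whenever `det T₂` is a unit.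
* `isUnit_det_fromBlocks_neg` (`det (T ⊕ −T)` is a unit when `det T` is), `isUnit_fromBlocks_zero_one`
  (`A₀ = fromBlocks 0 T 1 0` is invertible when `T` is).
* the adelic/rational form **`ratSpι F (ι ⊕ ι) T₂ hT deltaDiag ((T y|₂, T y|₂), (y|₁, y|₁)) = (0, y)`** for all
  `y ∈ 𝔸_F^{ι⊕ι}` (`ratSpι_deltaDiag_diag`) — the hypothesis `hW` of the diagonal-kernel identity with
  `γ = deltaDiag`, `A₀ = fromBlocks 0 T₀ 1 0`.

Sources.  [Li1992] J.-S. Li, J. reine angew. Math. 428 (1992), p. 181 (the element `δ`); [Weil1964] Chap. III n° 37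
p. 188 (rational points of the symplectic group act through `r`).  Statements tagged `[folklore]` are routine linear
algebra on the tree's definitions.
-/

set_option autoImplicit false

noncomputable section

open scoped Matrix

namespace Literature.NumberTheory.Weil1964

open Literature.RepresentationTheory.HeisenbergGroup Literature.RepresentationTheory.HeisenbergGroup.SymplecticMatrix
  NumberField

/-! ## §1 The matrix `δ` and its membership in `Sp_{2(ι⊕ι)}` -/

section Generic

variable (K : Type*) [CommRing K] (ι : Type*) [Fintype ι] [DecidableEq ι]

/-- **the matrix `δ`**: `(X₁, X₂; Y₁, Y₂) ↦ (X₁ − X₂, Y₁ + Y₂; Y₁, −X₂)` on `K^{(ι⊕ι)⊕(ι⊕ι)}` (Darboux coordinates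
`(X; Y)` of `𝕎 = W ⊕ W⁻`). [folklore] -/
def deltaDiagMatrix : Matrix ((ι ⊕ ι) ⊕ (ι ⊕ ι)) ((ι ⊕ ι) ⊕ (ι ⊕ ι)) K :=
  Matrix.fromBlocks (Matrix.fromBlocks 1 (-1) 0 0) (Matrix.fromBlocks 0 0 1 1)
    (Matrix.fromBlocks 0 0 0 (-1)) (Matrix.fromBlocks 1 0 0 0)

/-- `δ` is symplectic: `δ J δᵀ = J`. [folklore] -/
theorem deltaDiagMatrix_mem : deltaDiagMatrix K ι ∈ Matrix.symplecticGroup (ι ⊕ ι) K := by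
  rw [SymplecticGroup.mem_iff, Matrix.J, deltaDiagMatrix]
  have h1 : (Matrix.fromBlocks (-1 : Matrix ι ι K) (0 : Matrix ι ι K) (0 : Matrix ι ι K) (-1 : Matrix ι ι K)) =
      (-1 : Matrix (ι ⊕ ι) (ι ⊕ ι) K) := by
    rw [← Matrix.fromBlocks_one, Matrix.fromBlocks_neg, neg_zero]
  simp only [Matrix.fromBlocks_transpose, Matrix.fromBlocks_multiply, Matrix.transpose_zero, Matrix.transpose_one,
    Matrix.transpose_neg, Matrix.mul_zero, Matrix.mul_one, Matrix.mul_neg, neg_zero, zero_add, add_zero, neg_neg,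
    Matrix.fromBlocks_neg, Matrix.fromBlocks_add, Matrix.fromBlocks_zero, Matrix.fromBlocks_one, add_neg_cancel,
    neg_add_cancel, h1]

/-- **`δ ∈ Sp_{2(ι⊕ι)}(K)`** as an element of Mathlib's symplectic group. [cite: Li1992, p. 181] -/
def deltaDiag : Matrix.symplecticGroup (ι ⊕ ι) K := ⟨deltaDiagMatrix K ι, deltaDiagMatrix_mem K ι⟩

/-- its matrix. [folklore] -/
@[simp] theorem coe_deltaDiag :
    ((deltaDiag K ι : Matrix.symplecticGroup (ι ⊕ ι) K) : Matrix ((ι ⊕ ι) ⊕ (ι ⊕ ι)) ((ι ⊕ ι) ⊕ (ι ⊕ ι)) K) =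
      deltaDiagMatrix K ι :=
  rfl

variable {K ι} in
omit [Fintype ι] in
/-- `δ` is defined over the prime ring: entrywise ring maps fix it. [folklore] -/
theorem deltaDiagMatrix_map {K' : Type*} [CommRing K'] (f : K →+* K') :
    (deltaDiagMatrix K ι).map f = deltaDiagMatrix K' ι := by
  simp only [deltaDiagMatrix, Matrix.fromBlocks_map, Matrix.map_zero _ (map_zero f), Matrix.map_neg _ (map_neg f),
    Matrix.map_one f (map_zero f) (map_one f)]

variable {K ι} in
/-- `mapHom f δ = δ`. [folklore] -/
theorem mapHom_deltaDiag {K' : Type*} [CommRing K'] (f : K →+* K') : mapHom f (deltaDiag K ι) = deltaDiag K' ι :=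
  Subtype.ext (by rw [coe_mapHom, coe_deltaDiag, coe_deltaDiag, deltaDiagMatrix_map])

/-! ## §2 `δ` carries the diagonal `W^Δ` onto `𝕐` -/

variable {K ι}
variable (T : Matrix ι ι K) (hT₂ : IsUnit (Matrix.fromBlocks T 0 0 (-T)).det)

/-- the action of `δ` in Darboux coordinates on a diagonal point: `δ ((a, a); (c, −c)) = (0; (c, −a))`. [folklore] -/
theorem deltaDiagMatrix_mulVec_diag (a c : ι → K) :
    deltaDiagMatrix K ι *ᵥ Sum.elim (Sum.elim a a) (Sum.elim c (-c)) = Sum.elim (0 : ι ⊕ ι → K) (Sum.elim c (-a)) := by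
  simp only [deltaDiagMatrix, Matrix.fromBlocks_mulVec, Sum.elim_comp_inl, Sum.elim_comp_inr, Matrix.one_mulVec,
    Matrix.neg_mulVec, Matrix.zero_mulVec, add_zero, zero_add]
  funext i
  rcases i with (i | i) | (i | i) <;>
    simp only [Sum.elim_inl, Sum.elim_inr, Pi.add_apply, Pi.neg_apply, Pi.zero_apply, add_neg_cancel, add_zero, zero_add]

/-- **`δ` CARRIES `W^Δ` ONTO `𝕐`**: in the tree's model `𝕎 = 𝕏 ⊕ 𝕐` of the doubled space with Gram matrix
`T₂ = T ⊕ (−T)`, `(transportSp T₂ δ) ((T y₂, T y₂), (y₁, y₁)) = (0, (y₁, y₂))`. [cite: Li1992, p. 181] -/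
theorem transportSp_deltaDiag_diag (y₁ y₂ : ι → K) :
    ((transportSp (Matrix.fromBlocks T 0 0 (-T)) hT₂ (deltaDiag K ι) :
        symplecticGroup (polar (Matrix.toLinearMap₂' K (Matrix.fromBlocks T 0 0 (-T))))) :
        ((ι ⊕ ι → K) × (ι ⊕ ι → K)) ≃ₗ[K] ((ι ⊕ ι → K) × (ι ⊕ ι → K)))
      (Sum.elim (T *ᵥ y₂) (T *ᵥ y₂), Sum.elim y₁ y₁) = (0, Sum.elim y₁ y₂) := by
  rw [coe_transportSp_apply, coe_deltaDiag, darboux_apply]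
  have h1 : Matrix.fromBlocks T 0 0 (-T) *ᵥ Sum.elim y₁ y₁ = Sum.elim (T *ᵥ y₁) (-(T *ᵥ y₁)) := by
    simp only [Matrix.fromBlocks_mulVec, Sum.elim_comp_inl, Sum.elim_comp_inr, Matrix.zero_mulVec,
      Matrix.neg_mulVec, add_zero, zero_add]
  have h2 : Sum.elim (T *ᵥ y₁) (-(T *ᵥ y₂)) = Matrix.fromBlocks T 0 0 (-T) *ᵥ Sum.elim y₁ y₂ := by
    simp only [Matrix.fromBlocks_mulVec, Sum.elim_comp_inl, Sum.elim_comp_inr, Matrix.zero_mulVec,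
      Matrix.neg_mulVec, add_zero, zero_add]
  change (darboux _ hT₂).symm (deltaDiagMatrix K ι *ᵥ Sum.elim (Sum.elim (T *ᵥ y₂) (T *ᵥ y₂))
    (Matrix.fromBlocks T 0 0 (-T) *ᵥ Sum.elim y₁ y₁)) = _
  rw [h1, deltaDiagMatrix_mulVec_diag, h2, darboux_symm_sumElim, Matrix.mulVec_mulVec,
    Matrix.nonsing_inv_mul _ hT₂, Matrix.one_mulVec]

/-- the doubled Gram matrix `T ⊕ (−T)` is invertible when `T` is. [folklore] -/
theorem isUnit_det_fromBlocks_neg (hT : IsUnit T.det) : IsUnit (Matrix.fromBlocks T 0 0 (-T)).det := by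
  rw [Matrix.det_fromBlocks_zero₂₁, Matrix.det_neg]
  exact hT.mul (((isUnit_one.neg).pow _).mul hT)

omit hT₂ in
/-- the rational parametrisation `A₀ = fromBlocks 0 T₀ 1 0` of `W^Δ` by `𝕐` is invertible when `T₀` is (inverse
`fromBlocks 0 1 T₀⁻¹ 0`). [folklore] -/
theorem isUnit_fromBlocks_zero_one (hT : IsUnit T.det) :
    IsUnit (Matrix.fromBlocks 0 T 1 0 : Matrix (ι ⊕ ι) (ι ⊕ ι) K) := by
  have h : (Matrix.fromBlocks 0 T 1 0 : Matrix (ι ⊕ ι) (ι ⊕ ι) K) * Matrix.fromBlocks 0 1 T⁻¹ 0 = 1 := by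
    rw [Matrix.fromBlocks_multiply, Matrix.mul_nonsing_inv _ hT]
    simp only [Matrix.mul_zero, Matrix.zero_mul, Matrix.mul_one, zero_add, add_zero, Matrix.fromBlocks_one]
  exact ⟨⟨_, _, h, mul_eq_one_comm.1 h⟩, rfl⟩

end Generic

/-! ## §3 The rational `δ_F` acting on the adelic doubled space -/

section Adelic

variable (F : Type) [Field F] [NumberField F] (ι : Type) [Fintype ι] [DecidableEq ι]
variable (T : Matrix ι ι (AdeleRing (𝓞 F) F)) (hT₂ : IsUnit (Matrix.fromBlocks T 0 0 (-T)).det)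

/-- **`r`-image of the rational `δ_F` carries `W^Δ(𝔸)` onto `𝕐(𝔸)`**:
`ratSpι F (ι ⊕ ι) T₂ hT δ_F ((T y|₂, T y|₂), (y|₁, y|₁)) = (0, y)` for every `y ∈ 𝔸_F^{ι ⊕ ι}` — the hypothesis
`hW` of the diagonal-kernel identity, with `γ = δ_F` and the rational parametrisation `A₀ = fromBlocks 0 T₀ 1 0`
when `T = T₀ ⊗ 1`. [cite: Li1992, p. 181; Weil1964, Chap. III n° 37 p. 188] -/
theorem ratSpι_deltaDiag_diag (y : ι ⊕ ι → AdeleRing (𝓞 F) F) :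
    ((ratSpι F (ι ⊕ ι) (Matrix.fromBlocks T 0 0 (-T)) hT₂ (deltaDiag F ι) :
        symplecticGroup (polar (adelicForm F (ι ⊕ ι) (Matrix.fromBlocks T 0 0 (-T))))) :
        ((ι ⊕ ι → AdeleRing (𝓞 F) F) × (ι ⊕ ι → AdeleRing (𝓞 F) F)) ≃ₗ[AdeleRing (𝓞 F) F]
          ((ι ⊕ ι → AdeleRing (𝓞 F) F) × (ι ⊕ ι → AdeleRing (𝓞 F) F)))
      (Sum.elim (T *ᵥ (y ∘ Sum.inr)) (T *ᵥ (y ∘ Sum.inr)), Sum.elim (y ∘ Sum.inl) (y ∘ Sum.inl)) = (0, y) := by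
  rw [ratSpι, MonoidHom.comp_apply, mapHom_deltaDiag]
  have h := transportSp_deltaDiag_diag T hT₂ (y ∘ Sum.inl) (y ∘ Sum.inr)
  rw [Sum.elim_comp_inl_inr] at h
  exact h

/-- the same with the rational parametrisation written as a matrix: for `T = T₀ ⊗ 1` and
`A₀ = fromBlocks 0 T₀ 1 0 ∈ GL_{ι⊕ι}(F)`, `r(δ_F) (((A₀ y)|₁, (A₀ y)|₁), ((A₀ y)|₂, (A₀ y)|₂)) = (0, y)`. [folklore] -/
theorem ratSpι_deltaDiag_param (T₀ : Matrix ι ι F)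
    (hT₂ : IsUnit (Matrix.fromBlocks (T₀.map (algebraMap F (AdeleRing (𝓞 F) F))) 0 0
      (-(T₀.map (algebraMap F (AdeleRing (𝓞 F) F))))).det)
    (y : ι ⊕ ι → AdeleRing (𝓞 F) F) :
    ((ratSpι F (ι ⊕ ι) (Matrix.fromBlocks (T₀.map (algebraMap F (AdeleRing (𝓞 F) F))) 0 0
        (-(T₀.map (algebraMap F (AdeleRing (𝓞 F) F))))) hT₂ (deltaDiag F ι) :
        symplecticGroup (polar (adelicForm F (ι ⊕ ι) (Matrix.fromBlocks (T₀.map (algebraMap F (AdeleRing (𝓞 F) F)))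
          0 0 (-(T₀.map (algebraMap F (AdeleRing (𝓞 F) F)))))))) :
        ((ι ⊕ ι → AdeleRing (𝓞 F) F) × (ι ⊕ ι → AdeleRing (𝓞 F) F)) ≃ₗ[AdeleRing (𝓞 F) F]
          ((ι ⊕ ι → AdeleRing (𝓞 F) F) × (ι ⊕ ι → AdeleRing (𝓞 F) F)))
      (Sum.elim (((Matrix.fromBlocks 0 T₀ 1 0 : Matrix (ι ⊕ ι) (ι ⊕ ι) F).map
            (algebraMap F (AdeleRing (𝓞 F) F)) *ᵥ y) ∘ Sum.inl)
          (((Matrix.fromBlocks 0 T₀ 1 0 : Matrix (ι ⊕ ι) (ι ⊕ ι) F).map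
            (algebraMap F (AdeleRing (𝓞 F) F)) *ᵥ y) ∘ Sum.inl),
        Sum.elim (((Matrix.fromBlocks 0 T₀ 1 0 : Matrix (ι ⊕ ι) (ι ⊕ ι) F).map
            (algebraMap F (AdeleRing (𝓞 F) F)) *ᵥ y) ∘ Sum.inr)
          (((Matrix.fromBlocks 0 T₀ 1 0 : Matrix (ι ⊕ ι) (ι ⊕ ι) F).map
            (algebraMap F (AdeleRing (𝓞 F) F)) *ᵥ y) ∘ Sum.inr)) = (0, y) := by
  have hA : (Matrix.fromBlocks 0 T₀ 1 0 : Matrix (ι ⊕ ι) (ι ⊕ ι) F).map (algebraMap F (AdeleRing (𝓞 F) F)) =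
      Matrix.fromBlocks 0 (T₀.map (algebraMap F (AdeleRing (𝓞 F) F))) 1 0 := by
    rw [Matrix.fromBlocks_map, Matrix.map_zero _ (map_zero _), Matrix.map_one _ (map_zero _) (map_one _)]
  have h1 : ((Matrix.fromBlocks 0 T₀ 1 0 : Matrix (ι ⊕ ι) (ι ⊕ ι) F).map (algebraMap F (AdeleRing (𝓞 F) F)) *ᵥ y) ∘
      Sum.inl = T₀.map (algebraMap F (AdeleRing (𝓞 F) F)) *ᵥ (y ∘ Sum.inr) := by
    rw [hA, ← Sum.elim_comp_inl_inr y, Matrix.fromBlocks_mulVec, Sum.elim_comp_inl_inr, Sum.elim_comp_inl,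
      Matrix.zero_mulVec, zero_add]
  have h2 : ((Matrix.fromBlocks 0 T₀ 1 0 : Matrix (ι ⊕ ι) (ι ⊕ ι) F).map (algebraMap F (AdeleRing (𝓞 F) F)) *ᵥ y) ∘
      Sum.inr = y ∘ Sum.inl := by
    rw [hA, ← Sum.elim_comp_inl_inr y, Matrix.fromBlocks_mulVec, Sum.elim_comp_inl_inr, Sum.elim_comp_inr,
      Matrix.one_mulVec, Matrix.zero_mulVec, add_zero]
  rw [h1, h2]
  exact ratSpι_deltaDiag_diag F ι _ hT₂ y

end Adelic

end Literature.NumberTheory.Weil1964
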